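import Literature.MathematicalPhysics.QuantumFieldTheory.Balaban1983to89.B9SmoothHolderClassPClosureSN
import Literature.MathematicalPhysics.QuantumFieldTheory.Balaban1983to89.B9Eq340ProbeBridgeSNtoKA

/-!
# `Balaban1983to89.B9SmoothHolderClassSliceSNDict` — T. Bałaban, *Propagators for lattice gauge theories in a background field*, Commun. Math. Phys. **99** (1985) 389–434
# [Balaban1985BackgroundPropagators], (3.44)–(3.45) p. 398 (the Hölder INPUT `‖λ‖_{β+ε} + |λ|` of `∇_UG′(U)∇\*_Uλ`): the DIRECTION SLICES `A ↦ A_μ(·)` carry dag-n06-l's print-weighted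
# transported BOND class `bHZKP (taxiB U) s` INTO the print-weighted transported SITE class `bHZP (taxiS U) s` — the Hölder-SOURCE sector comparison (brick B1 of the `h44G ∕ hp45W` road)

[4] = T. Bałaban, *Propagators and renormalization transformations for lattice gauge theories. II*, Commun. Math. Phys. **96** (1984) 223–250 [`Balaban1984PropagatorsII`].
statement-level skeleton of published theorems with citation tags; proofs where landed; nothing here is a claim about the Yang–Mills mass gap.

THE PRINT.  p. 391 «A_μ(x) = A(x, x + ηe_μ)»; (3.40) p. 397 (the transported quotient over `|x − x′| ≦ 1`); (3.44)–(3.45) p. 398; [4] (2.2) p. 224 (the bands `Λ_j`), (2.51)–(2.54) pp. 232–233,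
(2.137) p. 247 (admissible pairs).

WHY THIS FILE (cell `pub-ymgap`, node N06 [B9], seat `pub-ymgap-dag-n06-c` g19; road memo `pub-ymgap-dag-n06-c/HPDGW-ROAD.md`, brick B1).  The certificate's (3.44)/(3.45) binders `h44G ∕ hp45W`
read `∇_UG′∇\*_U` with SOURCE the bond class `bXH x U = bHZKPG (taxiB U) wX` (`hbXH`); n06-k's input engine (`B9RWSums344InputPairDir.inputPair3445_of_local37_dir`) works on the
direction-packed SITE carrier, fed by def-Y's `∇\*_U = c_fη·Σ_μ DscoS ∘ dirSliceK μ ν` (`Node00.OpsYNablaBridge`).  So the source must be SLICED: THIS FILE bounds `dirSliceK μ ν` from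
`bHZKP (taxiB U) s` into `bHZP (taxiS U) s` (same exponent).  Dictionary: a slice's assembled `μ′`-slot value at `chart x` IS `A`'s assembled `ν`-slot value at the bond `⟨x, μ⟩`
(`assembleK_dirSliceK`), the site table `taxiS` at charted points IS the bond table `taxiB` (both `parTaxiV` on base points), the site weight `wEta` IS the bond weight `wEtaK`
(`supDist = |·|_T` on the chart); the one genuine point: the site class ranges over NEAR site pairs (`|z − z′|_T ≤ L^{j(z)}`, one-sided) while the bond class ranges over ADMISSIBLE pairs
((2.137): the bound at BOTH base points) — a near, non-admissible pair has `j(z′) = j(z) − 1` exactly (levels of near sites differ by ≤ 1, [4] (2.2) in the torus distance, `sepT`),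
its weight is `≤ L^{2s}·(Lʲη)^{−s}` at the localisation block and its difference is read through the SUP channel (`2c_bb_b·sup|A|`); an admissible pair whose first point lies off
`Δ̃(y′)` is read through the REVERSED pair (unitary transport, `c_bb_b`).  Kernel: `C·e^{δr}·e^{−δd(y,y′)}` with the LAYER-B radius.
THIS FILE = §1, the GEOMETRY AND DICTIONARY (the comparison theorem itself is the sequel `B9SmoothHolderClassSliceSN`):
* ★ `levY_window_of_nearS` (two-sided level window for near sites), ★ `trDif_dirSliceK` / `wEta_chartY_eq_wEtaK` / `nearPairK_of_adm` (dictionary),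
  `len_le_of_lvl_le` / `rpow_le_of_le_mul` / `wEtaK_le_of_lt` (the weight comparisons).
HONEST SCOPE.  Class bookkeeping; no estimate of [B9] asserted; COUNT-NEUTRAL; N06 NOT discharged; nothing continuum, nothing about the mass gap.  Cell `pub-ymgap` (HUMAN RULING D-0062),
Track A node N06 [B9], seat `pub-ymgap-dag-n06-c` (g19), 2026-08-29; a NEW file; 0 `def`, no `sorry`, no `axiom`, no `instance`, no `notation`.
-/

noncomputable section

namespace Literature.MathematicalPhysics.QuantumFieldTheory.Balaban1983to89.B9SmoothHolderClassSliceSNDict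

open B4Reflection242 (boxDom)
open B4TorusKernel.MultiPeriod (torusSupNorm torusSupNorm_nonneg)
open B6GlobalChartV1 (PV blkV1)
open B6Geom246MultiLevelTorus (geomT torusSupNorm_neg)
open B6Ineq2142KLevelV1 (β lvl)
open B6KLevelCensusIndexV1 (KIdx Adm)
open B6MultiLevelBoxOperator (N0 bigSide one_le_bigSide)
open B6MultiLevelTorusOperator (one_le_of_mem)
open B6Prop22KLevelTorusCensusEta (nKT nKT_pos)
open B9GeoNormsKLevelV1 (geo9K)
open B9GeoLemma21KLevelV1 (geo9K_dist_triangle geo9K_len_pos geo9K_dist_comm)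
open B9Thm34Ext (toB6)
open B11SectG (BlockNorm HasMaj)
open B11SectGGlobal (Size)
open B11SectGGlobalSizes
open B11SectGSmoothCutT (Size.ofPairsT ofPairsT_sz_le ofPairsT_term_le)
open B9Eq39Adjoint (R)
open B9Thm39ReadingCoords (coordBound39 basisBound39 abs_repr_le)
open B9CoReadingCoords (assembleK XBK)
open B9CoReadingCoordsS (XSK sIK)
open B9MultiscaleSmoothPartitionY (scl scl_pos NearY levY_window_of_nearY)
open B9MultiscaleSmoothPartitionYNear (rNear dist_sIK_le_of_nearY)
open B9SmoothHolderClassS (NearPair wEta wEta_nonneg Wscl Wscl_nonneg scl_div_nKT_pos_le_one one_le_Wscl)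
open B9SmoothHolderClassK (srcY NearPairK wEtaK wEtaK_nonneg)
open B9SmoothHolderClassT (trDif trDif_apply)
open B9SmoothHolderClassTClosure (len_rpow_neg_eq_Wscl len_le_one len_eq_scl_div)
open B9SmoothHolderClassP (bHZP bHZP_loc bHZKP bHZKP_loc bHZKP_isLoc_iff)
open B9SmoothHolderClassTGradientTools (lvl_sIK_eq_levY)
open B9GradViaDivLettersSmoothTerms (blkV1_level_eq_levY Wscl_le_of_lvl_le)
open B9GradViaDivLettersTransported (taxiS taxiB)
open B9GradViaDivLettersAtPinsHolderPairs (sIK_chartY)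
open B9CoReadingCoordsHolderSNear (NearS)
open B9Eq340ProbeBridgeSNtoKA (supDist_eq_torusSupNorm)
open Node00 (SiteY FBondY IBondY CfgY toKT levY)
open Node00.OpsYNablaBridge (chartY dirSliceK dirSliceK_apply assembleK_dirSliceK bondCompY)
open LatticeFieldCalculus (supDist)
open B6GlobalChartV1 (boxEquiv)
open T4RelativeLadder (UnitaryLike)
open Node00.OpsYSectDCoords (repr_assembleK)
open B9Thm33G0ProbeZeroAtPinsAdm (norm_assembleK_le unitaryLike_parTaxiV)
open B9Eq340TaxiTelescope (norm_R_le)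

variable {d ℓ : ℕ} {hd : 1 ≤ d + 1} {hL : Odd (ℓ + 1) ∧ 1 < ℓ + 1} {b₀ b₁ : ℝ}
variable {𝔸 : Type} [NormedRing 𝔸] [NormedAlgebra ℂ 𝔸] [CompleteSpace 𝔸]
variable {κ : Type} [Fintype κ]
variable (i : KIdx d ℓ hd hL b₀ b₁)

/-! ## §1 Geometry and dictionary -/

section Geometry

omit [NormedAlgebra ℂ 𝔸] [CompleteSpace 𝔸] [Fintype κ] in
/-- ★ **NEAR SITES HAVE LEVELS DIFFERING BY AT MOST ONE**: `|z − z′|_T ≤ L^{j(z)}` forces `j(z) ≤ j(z′) + 1` and `j(z′) ≤ j(z) + 1` ([4] (2.2): the bands `Λ_j` are wider than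
`R·M·L^{j+1} > Lʲ` in the torus distance). [cite: Balaban1984PropagatorsII, (2.2) p.224] -/
theorem levY_window_of_nearS {z z' : SiteY i} (h : NearS i z z') : levY i z ≤ levY i z' + 1 ∧ levY i z' ≤ levY i z + 1 := by
  have hR1 : 1 ≤ (toKT i).R := le_trans (by omega) (toKT i).hR
  have hL1 : (1 : ℝ) ≤ ((ℓ + 1 : ℕ) : ℝ) := by exact_mod_cast Nat.succ_le_succ (Nat.zero_le ℓ)
  -- `L^{j(z)} < R·M_h·L^{j+1}` for every `j ≥ j(z) − 1`
  have key : ∀ j : ℕ, levY i z ≤ j + 1 → (((ℓ + 1 : ℕ) : ℝ)) ^ levY i z < (((toKT i).R * bigSide ℓ (toKT i).Mh j : ℕ) : ℝ) := by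
    intro j hj
    have h1 : (((ℓ + 1 : ℕ) : ℝ)) ^ levY i z ≤ (((ℓ + 1 : ℕ) : ℝ)) ^ (j + 1) := pow_le_pow_right₀ hL1 hj
    have h2 : (((ℓ + 1 : ℕ) : ℝ)) ^ (j + 1) ≤ (bigSide ℓ (toKT i).Mh j : ℝ) := by
      rw [bigSide]; push_cast
      exact le_mul_of_one_le_left (by positivity) (by exact_mod_cast (toKT i).hMh)
    have h3 : (bigSide ℓ (toKT i).Mh j : ℝ) ≤ (((toKT i).R * bigSide ℓ (toKT i).Mh j : ℕ) : ℝ) := by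
      push_cast; exact le_mul_of_one_le_left (by positivity) (by exact_mod_cast hR1)
    have h4 : (((ℓ + 1 : ℕ) : ℝ)) ^ (j + 1) < (((ℓ + 1 : ℕ) : ℝ)) ^ (j + 1) + 1 := lt_add_one _
    -- strictness: `L^{j+1} ≤ M_h L^{j+1} ≤ R M_h L^{j+1}` and `L^{j(z)} ≤ L^{j+1}`; make it strict using `R ≥ 2(ℓ+1) ≥ 2`
    have hR2 : (2 : ℝ) ≤ ((toKT i).R : ℝ) := by
      have := (toKT i).hR; exact_mod_cast le_trans (by omega) this
    have h5 : (((toKT i).R * bigSide ℓ (toKT i).Mh j : ℕ) : ℝ) ≥ 2 * (bigSide ℓ (toKT i).Mh j : ℝ) := by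
      push_cast; exact mul_le_mul_of_nonneg_right hR2 (by positivity)
    have h6 : (0 : ℝ) < (bigSide ℓ (toKT i).Mh j : ℝ) := by exact_mod_cast one_le_bigSide (toKT i).hMh j
    linarith
  unfold NearS at h
  constructor
  · -- if `j(z) ≥ j(z′) + 2`: `sepT` at `j := j(z) − 1` between `z′` (level `< j`) and `z` (level `≥ j + 1`)
    by_contra hlt
    push Not at hlt
    have hsep := (toKT i).D.sepT (levY i z - 1) z'.1 z'.2 z.1 z.2 (by unfold levY at hlt ⊢; omega) (by unfold levY at hlt ⊢; omega)
    have hk := key (levY i z - 1) (by omega)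
    rw [← neg_sub, torusSupNorm_neg (fun μ => one_le_of_mem z.2 μ)] at hsep
    exact absurd (h.trans_lt hk) (not_lt.2 hsep.le)
  · -- if `j(z′) ≥ j(z) + 2`: `sepT` at `j := j(z) + 1` between `z` (level `< j`) and `z′` (level `≥ j + 1`)
    by_contra hlt
    push Not at hlt
    have hsep := (toKT i).D.sepT (levY i z + 1) z.1 z.2 z'.1 z'.2 (by unfold levY at hlt ⊢; omega) (by unfold levY at hlt ⊢; omega)
    have hk := key (levY i z + 1) (by omega)
    exact absurd (h.trans_lt hk) (not_lt.2 hsep.le)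

end Geometry

section Dictionary

variable (b : Module.Basis κ ℝ 𝔸) {B : B9.Backgrounds} (cfg : B.Cfg → CfgY 𝔸 i) (U₁ : B.Cfg)

/-- ★ the site pair term of a slice IS the bond pair term: `Δ^{taxiS}(chart x, chart x′) (dirSliceK μ ν A) = Δ^{taxiB}(⟨x,μ⟩, ⟨x′,μ⟩) A` (slot `μ′` read as slot `ν`).
[cite: Balaban1985BackgroundPropagators, (3.40) p.397 + p.391, bookkeeping] -/
theorem trDif_dirSliceK (A : XBK κ i → ℝ) (x x' : Site (PV d ℓ i.m i.K hd hL) 0) (μ ν μ' : Fin (d + 1)) (a c : κ) :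
    trDif b (taxiS i B cfg U₁) (chartY i x, μ', a, c) (chartY i x', μ', a, c) (dirSliceK i μ ν A) =
      trDif b (taxiB i B cfg U₁) (⟨x, μ⟩, ν, a, c) (⟨x', μ⟩, ν, a, c) A := by
  rw [trDif_apply, trDif_apply]
  dsimp only
  rw [assembleK_dirSliceK]
  show b.repr (assembleK b ν c A ⟨(chartY i).symm (chartY i x), μ⟩ -
      R (Node00.parTaxiV (cfg U₁) ((boxEquiv i.hN).symm (chartY i x)) ((boxEquiv i.hN).symm (chartY i x')))
        (assembleK b ν c A ⟨(chartY i).symm (chartY i x'), μ⟩)) a =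
    b.repr (assembleK b ν c A ⟨x, μ⟩ - R (Node00.parTaxiV (cfg U₁) x x') (assembleK b ν c A ⟨x', μ⟩)) a
  have e1 : (chartY i).symm (chartY i x) = x := Equiv.symm_apply_apply _ _
  have e1' : (chartY i).symm (chartY i x') = x' := Equiv.symm_apply_apply _ _
  have e2 : (boxEquiv i.hN).symm (chartY i x) = x := (boxEquiv i.hN).symm_apply_apply x
  have e2' : (boxEquiv i.hN).symm (chartY i x') = x' := (boxEquiv i.hN).symm_apply_apply x'
  rw [e1, e1', e2, e2']

omit [NormedAlgebra ℂ 𝔸] [CompleteSpace 𝔸] [Fintype κ] in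
/-- ★ the site weight at charted points IS the bond weight: `wEta s (chart x, ·) (chart x′, ·) = wEtaK s (⟨x,μ⟩, ·) (⟨x′,μ⟩, ·)` (`|·|_T` on the chart = `supDist`).
[cite: Balaban1985BackgroundPropagators, (3.40) p.397; Balaban1984PropagatorsII, (2.1) p.224, bookkeeping] -/
theorem wEta_chartY_eq_wEtaK (s : ℝ) (x x' : Site (PV d ℓ i.m i.K hd hL) 0) (μ ν μ' : Fin (d + 1)) (a c a' c' : κ) :
    wEta i s (chartY i x, μ', a, c) (chartY i x', μ', a', c') = wEtaK (κ := κ) i s (⟨x, μ⟩, ν, a, c) (⟨x', μ⟩, ν, a', c') := by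
  rw [wEta, wEtaK]
  dsimp only
  rw [supDist_eq_torusSupNorm i x x', ← neg_sub, torusSupNorm_neg (fun μ => one_le_of_mem (chartY i x).2 μ)]

omit [NormedRing 𝔸] [NormedAlgebra ℂ 𝔸] [CompleteSpace 𝔸] [Fintype κ] in
/-- ★ a near site pair at charted points which is ADMISSIBLE as a bond pair is a near bond pair. [cite: Balaban1984PropagatorsII, (2.137) p.247, bookkeeping] -/
theorem nearPairK_of_adm {x x' : Site (PV d ℓ i.m i.K hd hL) 0} {μ ν : Fin (d + 1)} {a c : κ} (hne : x ≠ x') (hadm : Adm i ⟨x, μ⟩ ⟨x', μ⟩) :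
    NearPairK (κ := κ) i (⟨x, μ⟩, ν, a, c) (⟨x', μ⟩, ν, a, c) :=
  ⟨fun h => hne (by have := congrArg (fun f : FBondY i => f.src) h; exact this), hadm, rfl⟩

end Dictionary

/-! ## §1b The weight comparisons -/

section Main

variable [Fintype (geo9K i).Site] (b : Module.Basis κ ℝ 𝔸) {B : B9.Backgrounds} (cfg : B.Cfg → CfgY 𝔸 i) (U₁ : B.Cfg)
variable {R₀ : ℝ} {H₀ : Prop} {bI : FBondY i → IBondY i}

omit [NormedAlgebra ℂ 𝔸] [CompleteSpace 𝔸] [Fintype κ] [Fintype (geo9K i).Site] in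
/-- levels `j(y′) ≤ j(y) + k` give lengths `Lʲ′η ≤ Lᵏ·Lʲη`. [cite: Balaban1984PropagatorsII, (2.1) p.224, bookkeeping] -/
theorem len_le_of_lvl_le (hcf : |i.cf| = (nKT (toKT i) : ℝ)) {y y' : IBondY i} {k : ℕ} (h : lvl i.hN i.D i.hk y' ≤ lvl i.hN i.D i.hk y + k) :
    (geo9K i).len y' ≤ (((ℓ + 1 : ℕ) : ℝ)) ^ k * (geo9K i).len y := by
  have hL1 : (1 : ℝ) ≤ ((ℓ + 1 : ℕ) : ℝ) := by exact_mod_cast Nat.succ_le_succ (Nat.zero_le ℓ)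
  have hN : (0 : ℝ) < (nKT (toKT i) : ℝ) := nKT_pos _
  rw [len_eq_scl_div i hcf, len_eq_scl_div i hcf, scl, scl, mul_div_assoc', ← pow_add]
  exact div_le_div_of_nonneg_right (pow_le_pow_right₀ hL1 (by omega)) hN.le

omit [NormedAlgebra ℂ 𝔸] [CompleteSpace 𝔸] [Fintype κ] in
/-- `x ≤ Lᵏ·y` gives `x^t ≤ Lᵏ·y^t` for `0 ≤ t ≤ 1`, `0 ≤ x, y` (the Hölder-weight form of a level window). [cite: Balaban1984PropagatorsII, (2.1) p.224, bookkeeping] -/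
theorem rpow_le_of_le_mul {x y t : ℝ} {k : ℕ} (hx : 0 ≤ x) (hy : 0 ≤ y) (ht0 : 0 ≤ t) (ht1 : t ≤ 1) (h : x ≤ (((ℓ + 1 : ℕ) : ℝ)) ^ k * y) :
    x ^ t ≤ (((ℓ + 1 : ℕ) : ℝ)) ^ k * y ^ t := by
  have hL1 : (1 : ℝ) ≤ ((ℓ + 1 : ℕ) : ℝ) := by exact_mod_cast Nat.succ_le_succ (Nat.zero_le ℓ)
  have hLk : (1 : ℝ) ≤ (((ℓ + 1 : ℕ) : ℝ)) ^ k := one_le_pow₀ hL1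
  calc x ^ t ≤ ((((ℓ + 1 : ℕ) : ℝ)) ^ k * y) ^ t := Real.rpow_le_rpow hx h ht0
    _ = ((((ℓ + 1 : ℕ) : ℝ)) ^ k) ^ t * y ^ t := Real.mul_rpow (by positivity) hy
    _ ≤ (((ℓ + 1 : ℕ) : ℝ)) ^ k * y ^ t := by
        refine mul_le_mul_of_nonneg_right ?_ (Real.rpow_nonneg hy _)
        calc ((((ℓ + 1 : ℕ) : ℝ)) ^ k) ^ t ≤ ((((ℓ + 1 : ℕ) : ℝ)) ^ k) ^ (1 : ℝ) := Real.rpow_le_rpow_of_exponent_le hLk ht1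
          _ = _ := Real.rpow_one _

omit [NormedAlgebra ℂ 𝔸] [CompleteSpace 𝔸] [Fintype κ] [Fintype (geo9K i).Site] in
/-- the bond weight of a NON-admissible near pair: `wEtaK s q q′ ≤ L²·Wscl s y′` when `|x − x′|_∞ > L^{j}` and `j(y′) ≤ j + 2`.
[cite: Balaban1985BackgroundPropagators, (3.40) p.397; Balaban1984PropagatorsII, (2.137) p.247, bookkeeping] -/
theorem wEtaK_le_of_lt {s : ℝ} (hs0 : 0 ≤ s) (hs1 : s ≤ 1) {q q' : XBK κ i} {j : ℕ} {y' : IBondY i}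
    (hlt : (ℓ + 1) ^ j < supDist q.1.src q'.1.src) (hj : lvl i.hN i.D i.hk y' ≤ j + 2) :
    wEtaK i s q q' ≤ (((ℓ + 1 : ℕ) : ℝ)) ^ 2 * Wscl i s y' := by
  have hL1 : (1 : ℝ) ≤ ((ℓ + 1 : ℕ) : ℝ) := by exact_mod_cast Nat.succ_le_succ (Nat.zero_le ℓ)
  have hL2 : (1 : ℝ) ≤ (((ℓ + 1 : ℕ) : ℝ)) ^ 2 := one_le_pow₀ hL1
  have hL20 : (0 : ℝ) < (((ℓ + 1 : ℕ) : ℝ)) ^ 2 := by positivity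
  have hN : (0 : ℝ) < (nKT (toKT i) : ℝ) := nKT_pos _
  have hscl : 0 < scl i y' := scl_pos i y'
  -- `scl y′ ≤ L²·|x − x′|_∞`
  have h1 : scl i y' ≤ (((ℓ + 1 : ℕ) : ℝ)) ^ 2 * (supDist q.1.src q'.1.src : ℝ) := by
    rw [scl]
    have h3 : (((ℓ + 1 : ℕ) : ℝ)) ^ j ≤ (supDist q.1.src q'.1.src : ℝ) := by exact_mod_cast hlt.le
    calc (((ℓ + 1 : ℕ) : ℝ)) ^ lvl i.hN i.D i.hk y' ≤ (((ℓ + 1 : ℕ) : ℝ)) ^ (j + 2) := pow_le_pow_right₀ hL1 hj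
      _ = (((ℓ + 1 : ℕ) : ℝ)) ^ 2 * (((ℓ + 1 : ℕ) : ℝ)) ^ j := by ring
      _ ≤ _ := mul_le_mul_of_nonneg_left h3 hL20.le
  set a : ℝ := scl i y' / (nKT (toKT i) : ℝ) with ha
  set c : ℝ := (supDist q.1.src q'.1.src : ℝ) / (nKT (toKT i) : ℝ) with hc
  have ha0 : 0 < a := by positivity
  have hac : a / (((ℓ + 1 : ℕ) : ℝ)) ^ 2 ≤ c := by
    rw [div_le_iff₀ hL20, ha, hc, div_mul_eq_mul_div, div_le_div_iff_of_pos_right hN]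
    linarith
  have haL : 0 < a / (((ℓ + 1 : ℕ) : ℝ)) ^ 2 := by positivity
  rw [wEtaK, Wscl, ← hc, ← ha]
  calc (c ^ s)⁻¹ ≤ ((a / (((ℓ + 1 : ℕ) : ℝ)) ^ 2) ^ s)⁻¹ := inv_anti₀ (Real.rpow_pos_of_pos haL _) (Real.rpow_le_rpow haL.le hac hs0)
    _ = ((((ℓ + 1 : ℕ) : ℝ)) ^ 2) ^ s * (a ^ s)⁻¹ := by
        rw [Real.div_rpow ha0.le hL20.le, inv_div, div_eq_mul_inv]
    _ ≤ (((ℓ + 1 : ℕ) : ℝ)) ^ 2 * (a ^ s)⁻¹ := by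
        refine mul_le_mul_of_nonneg_right ?_ (inv_nonneg.2 (Real.rpow_nonneg ha0.le _))
        calc ((((ℓ + 1 : ℕ) : ℝ)) ^ 2) ^ s ≤ ((((ℓ + 1 : ℕ) : ℝ)) ^ 2) ^ (1 : ℝ) := Real.rpow_le_rpow_of_exponent_le hL2 hs1
          _ = _ := Real.rpow_one _

end Main

end Literature.MathematicalPhysics.QuantumFieldTheory.Balaban1983to89.B9SmoothHolderClassSliceSNDict

end
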